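import Mathlib
import Literature.MathematicalPhysics.QuantumFieldTheory.Balaban1983to89.B6Ineq268
import Literature.MathematicalPhysics.QuantumFieldTheory.Balaban1983to89.B6Ineq2142

/-!
# `Balaban1983to89.B6Ineq268From267` — T. Bałaban, *Propagators and renormalization transformations for lattice gauge
theories. II*, Commun. Math. Phys. **96** (1984) 223–250 [Balaban1984PropagatorsII], p. 235: *"The inequalities (2.67)
imply (2.68)"* — members 1–3 of (2.68) (the insertion of `Σ_{y″∈𝔅} Δ(y″) = I` between the two factors `G′` and
Proposition 2.2 applied twice) KERNEL-CHECKED for an actual linear `G′`, and chained with the tree's scale-sum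
certificate of members 3–6 (`…B6Ineq268.line2_le_line5`) into (2.68) end-to-end (the one-scale box instance, with no
hypothesis of printed shape left, is the companion `…B6Ineq268OneScaleBox`, same seat)

statement-level skeleton of published theorems with citation tags; proofs where landed; nothing here is a claim about the Yang–Mills mass gap.
PDF held: `paper:balaban1984-cmp96-propagators-rt-ii` (journal page = PDF page + 222); p. 235 [PDF 13] re-read AS AN IMAGE
this session on the ×2 render `run/shared/lean/pub/pub-balaban/b2b-balaban-ref1/pages/1984-cmp96-propagators-rt-II/
1984-cmp96-propagators-rt-II-p013-x2.png` (text layer `lit read paper:balaban1984-cmp96-propagators-rt-ii --pages 7-16`).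

CITATION HEADER (cell `lit-balaban`, HOME `run/shared/lean/pub/lit-balaban/`; Phase-2 proof seat `p01` gen 4 = unit
`lit-balaban-p01`; `PHASE2-TARGETS.md` §G, ruling G.5-34(d): finished seat, own-lane successor of this seat's rows
B6.Eq2.49/2.51/2.64/2.44/2.41/Prop2.2).  SKELETON row **`B6.Eq2.68`** of `HOME/lit-balaban-r03/ROWS-B6.md` (owner r03,
referee ref-4), Phase-2 kind «knitting implication» (G.2(b)); the «model instance» is the companion
`…B6Ineq268OneScaleBox`.  IMPORTED, NOT MODIFIED:
`…B6Ineq268` (cell pub-balaban b06-g5: `line2`, `line5`, `line2_le_line5`, `LevelSep`, `Symm`, `len_sq_eq` — members 3–6 of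
(2.68) and their exact threshold), `…B6Ineq2142` (r03 g5: the averaging operator `avgOp`, its (2.69)-adjoint `avgAdj`, the
(2.69)-kernel `kernelW`, and the sup-norm bookkeeping `abs_avgOp_le` / `abs_avgAdj_single_le` / `avgAdj_single_support`),
`…B6Prop23Chain` (`mat`), `…B6Expansion282` (`mulOp`), `…B6Geometry` (pv08: `Realizes`, `triangle254_of_realizes`,
`dist_comm_of_realizes`, `ineq260_of_levelGap`).

WHAT THE PAPER PRINTS (p. 235 [PDF 13], verbatim; y ∈ Λ_j, y′ ∈ Λ_{j′}, y″ ∈ Λ_{j″}, 𝔅 = ⋃_j Λ_j, Δ(y″) = the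
characteristic function of the block B^{j″}(y″) as in (2.52)):
*"Let us consider now the operator Q′G′²Q′* and its inverse (Q′G′²Q′*)⁻¹. The inequalities (2.67) imply
|(Q′G′²Q′*)(y, y′)| = |Σ_{y″∈𝔅} (Q′G′Δ(y″)G′Q′*)(y, y′)|
≤ Σ_{y″∈𝔅} O(1)(L^jη)² e^{−½δ₀d(y,y″)} (L^{j″}η)² (L^{j′}η)^{−d} e^{−½δ₀d(y″,y′)}
≤ O(1)(L^jη)⁴(L^{j′}η)^{−d} Σ_{y″∈𝔅} e^{−⅙δ₀d(y,y″)} L^{2(j″−j)} e^{−⅓δ₀d(y,y″)} e^{−⅓δ₀d(y″,y′)}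
≤ O(1)(L^jη)⁴(L^{j′}η)^{−d} Σ_{y″∈𝔅} e^{−⅙δ₀RM max{|j″−j|−1,0}} L^{2(j″−j)} · e^{−⅓δ₀d(y,y″)} e^{−⅓δ₀d(y″,y′)}
≤ O(1)(L^jη)⁴(L^{j′}η)^{−d} e^{−¼δ₀d(y,y′)}, (2.68) where we have used the inequalities (2.60), (2.63) of Lemma 1."*;
(2.69): *"⟨λ, λ′⟩ = Σ_{j=0}^k Σ_{y∈Λ_j} (L^jη)^d λ(y)λ′(y)"*; (2.67)₁ (Proposition 2.2, p. 234): *"|(G′λ)(x)| ≤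
O(1)(L^jη)² e^{−½δ₀d(y,y′)}|λ|, x ∈ B^j(y), y ∈ Λ_j, supp λ ⊂ B^{j′}(y′), y′ ∈ Λ_{j′}"*; (2.14)–(2.15) p. 225: Q′ = the
block averages *"(Q′_jλ)(y)"* (identity on Λ₀) and *"⟨ω, Q′λ⟩ = Σ_j Σ_{y∈Λ_j} (L^jη)^d ω(y)(Q′_jλ)(y)"*; p. 235:
*"If we have one scale, i.e. Λ_k = T₁^{(k)}, then the operator is a unit lattice operator."*

WHAT IS PROVED HERE (0 `sorry`, 0 definitions, 0 named facts; axioms = the standard three).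
§1 (fine lattice `X`, sites 𝔅 = `S`, block map `blk : X → S`, `Δ(y″) = mulOp 1_{blk = y″}`, ANY linear `G′` on `X → ℝ`,
   averaging kernel `q` supported blockwise with the two normalisation constants κ₁, κ₂ of `…B6Ineq2142`):
   `sum_blockProj` (`Σ_{y″} Δ(y″)F = F`), **`member1`** / `member1_kernel` (the printed first equality
   `(Q′G′²Q′*)(y,y′) = Σ_{y″}(Q′G′Δ(y″)G′Q′*)(y,y′)`, for matrix entries and for (2.69)-kernels), **`member23`**
   ((2.67)₁ at (y″, y′) and at (y, y″) ⇒ `|(Q′G′Δ(y″)G′Q′*δ_{y′})(y)| ≤ κ₁κ₂C²ℓ(y)²ℓ(y″)²e^{−δρ(y,y″)}e^{−δρ(y″,y′)}`),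
   `line2_abs_of_267` / `line2_kernel_of_267` (the sum over y″; kernel form with the factor `W(y′)⁻¹ = (L^{j′}η)^{−d}`).
§2 over the cell's carrier `g : B6.Geometry` (ℓ = `len` = L^jη, ρ = `dist` = d, W = len^d, rate ½δ₀):
   **`line2_of_267`**: (2.67)₁ ⇒ `|(Q′G′²Q′*)(y,y′)| ≤ κ₁κ₂C²·(L^jη)⁴(L^{j′}η)^{−d}·line2` (members 1–3, with
   (L^{j″}η)² = (L^jη)²L^{2(j″−j)}, `B6Ineq268.len_sq_eq`), and **`ineq268_of_267`**: + (2.54), symmetry of d, the metric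
   content `LevelSep` of (2.60), (2.61) at α = ¼ with constant c, and the located threshold L² ≤ e^{¼δ₀RM} of
   `…B6Ineq268` ⇒ **`|(Q′G′²Q′*)(y,y′)| ≤ κ₁κ₂C²L²c·(L^jη)⁴(L^{j′}η)^{−d}e^{−¼δ₀d(y,y′)}`** = (2.68) with its O(1) explicit;
   `ineq268_of_267_realizes`: the same with (2.54), symmetry and (2.60) DISCHARGED for geometries whose distance is the
   realised (2.46) of `…B6Geometry` under the walk form of (2.2) (`LevelGap`).
§2b (v1.1, APPEND-ONLY, same seat and session): **`hX_of_267`** — the conclusion rewritten LITERALLY as the hypothesis `hX`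
   (power p = 4, BX = κ₁κ₂C²L²c, rate parameter ½δ₀) of the tree's construction of (Q′G′²Q′*)⁻¹
   (`B6Prop27Kernel.inverse_assembled_pow`, assembled in `…B6Prop23Assembled` / `…B6Prop23Printed`), for the (2.69)-kernel
   X of Q′G′²Q′* whose kernel operator IS Q′G′²Q′* (`kerOp_kernelW_QGGQ`): Proposition 2.2 ⟶ (2.68) ⟶ the input of
   Proposition 2.3's chain, connected by name.
§3 (companion file `…B6Ineq268OneScaleBox`, same seat): the one-scale box instance (Q′ = I, G′ = (−Δ_𝔅 + a)⁻¹) with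
   EVERY hypothesis of `ineq268_of_267` discharged.
HONEST SCOPE.  (2.67) itself is NOT proved here in general: it enters §1–§2 in operator form as the displayed hypothesis
`h267` (on one scale it is this seat's gen-3 theorem — companion file).  Members 3–6 and their threshold are the imported
certificate of `…B6Ineq268` (whose header records that the print states no condition at this display; 8 log L ≤ δ₀RM is the located
one).  The regions of (2.67) (*"x ∈ B^j(y)"*, *"supp λ ⊂ B^{j′}(y′)"*) and the inserted Δ(y″) are the SAME block partition
`blk`; the averaging kernel is a parameter with the constants κ₁ (ℓ¹-mass) and κ₂ (relative volume) exactly as in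
`…B6Ineq2142` (for the printed block means κ₁ = κ₂ = 1).  Value = a kernel-checked derivation step of the paper; NOT summit
progress.
-/

namespace Literature.MathematicalPhysics.QuantumFieldTheory.Balaban1983to89.B6Ineq268From267

open Finset
open B6Prop23Chain (mat)
open B6Expansion282 (mulOp mulOp_apply)
open B6Ineq2142 (avgOp avgAdj kernelW avgOp_apply abs_avgOp_le abs_avgAdj_single_le avgAdj_single_support)

/-! ## §1 Members 1–3 of (2.68) on a fine lattice with a block partition -/

section Fine

variable {X S : Type} [Fintype X] [Fintype S] [DecidableEq S]

omit [Fintype X] in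
/-- `Σ_{y″∈𝔅} Δ(y″) = I`: the characteristic functions of the blocks `{x : blk x = y″}` sum to one, so
`Σ_{y″} Δ(y″)F = F` — the insertion behind the first equality of (2.68). [cite: Balaban1984PropagatorsII, (2.68) p.235] -/
theorem sum_blockProj (blk : X → S) (F : X → ℝ) :
    ∑ y'' : S, mulOp (fun x => if blk x = y'' then (1 : ℝ) else 0) F = F := by
  funext x
  rw [Finset.sum_apply]
  simp only [mulOp_apply, ite_mul, one_mul, zero_mul]
  rw [Finset.sum_ite_eq]
  simp

/-- **Member 1 of (2.68)** (matrix entries in the basis of point masses): `(Q′G′²Q′*δ_{y′})(y) =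
Σ_{y″∈𝔅} (Q′G′Δ(y″)G′Q′*δ_{y′})(y)`. [cite: Balaban1984PropagatorsII, (2.68) p.235] -/
theorem member1 (q : S → X → ℝ) (G : Module.End ℝ (X → ℝ)) (wX : ℝ) (W : S → ℝ) (blk : X → S) (y y' : S) :
    mat (avgOp q ∘ₗ G ∘ₗ G ∘ₗ avgAdj wX W q) y y' =
      ∑ y'' : S, mat (avgOp q ∘ₗ G ∘ₗ mulOp (fun x => if blk x = y'' then (1 : ℝ) else 0) ∘ₗ G ∘ₗ
        avgAdj wX W q) y y' := by
  simp only [B6Prop23Chain.mat, LinearMap.comp_apply]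
  conv_lhs => rw [← sum_blockProj blk (G (avgAdj wX W q (Pi.single y' 1)))]
  rw [map_sum, map_sum, Finset.sum_apply]

/-- **Member 1 of (2.68), (2.69)-kernel form** (verbatim shape): `(Q′G′²Q′*)(y,y′) = Σ_{y″∈𝔅}(Q′G′Δ(y″)G′Q′*)(y,y′)`
for the kernels `X(y,y′) = (Tδ_{y′})(y)/W(y′)` of the pairing (2.69). [cite: Balaban1984PropagatorsII, (2.68) p.235] -/
theorem member1_kernel (q : S → X → ℝ) (G : Module.End ℝ (X → ℝ)) (wX : ℝ) (W : S → ℝ) (blk : X → S) (y y' : S) :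
    kernelW W (avgOp q ∘ₗ G ∘ₗ G ∘ₗ avgAdj wX W q) y y' =
      ∑ y'' : S, kernelW W (avgOp q ∘ₗ G ∘ₗ mulOp (fun x => if blk x = y'' then (1 : ℝ) else 0) ∘ₗ G ∘ₗ
        avgAdj wX W q) y y' := by
  simp only [B6Ineq2142.kernelW]
  rw [member1 q G wX W blk y y', Finset.sum_div]

/-- **Members 2–3 of (2.68), term by term.**  For any linear `G′` with (2.67)₁ in operator form — `|(G′J)(x)| ≤
C·ℓ(b)²·e^{−δρ(b,b′)}·M` for `x ∈ B(b)` whenever `supp J ⊂ B(b′)` and `|J| ≤ M` — and any averaging kernel supported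
blockwise with `Σ_x|q(b,x)| ≤ κ₁`, `|q(b,x)| ≤ κ₂w_X/W(b)`: (2.67)₁ at (y″, y′) bounds `Δ(y″)G′Q′*δ_{y′}` by
`Cℓ(y″)²e^{−δρ(y″,y′)}κ₂` on its support `B(y″)`, and (2.67)₁ at (y, y″) then gives
`|(Q′G′Δ(y″)G′Q′*δ_{y′})(y)| ≤ κ₁κ₂C²ℓ(y)²ℓ(y″)²e^{−δρ(y,y″)}e^{−δρ(y″,y′)}`. [cite: Balaban1984PropagatorsII, (2.68) p.235] -/
theorem member23 (G : Module.End ℝ (X → ℝ)) (q : S → X → ℝ) (blk : X → S) {wX : ℝ} {W : S → ℝ}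
    (ℓ : S → ℝ) (ρ : S → S → ℝ) {C δ κ₁ κ₂ : ℝ}
    (hwX : 0 < wX) (hW : ∀ b, 0 < W b) (hC : 0 ≤ C) (hκ₂ : 0 ≤ κ₂)
    (hqR : ∀ b x, q b x ≠ 0 → blk x = b) (hq1 : ∀ b, ∑ x, |q b x| ≤ κ₁)
    (hq2 : ∀ b x, |q b x| ≤ κ₂ * wX / W b)
    (h267 : ∀ (b b' : S) (J : X → ℝ) (M : ℝ), (∀ x, J x ≠ 0 → blk x = b') → (∀ x, |J x| ≤ M) →
      ∀ x, blk x = b → |G J x| ≤ C * ℓ b ^ 2 * Real.exp (-(δ * ρ b b')) * M)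
    (y y'' y' : S) :
    |mat (avgOp q ∘ₗ G ∘ₗ mulOp (fun x => if blk x = y'' then (1 : ℝ) else 0) ∘ₗ G ∘ₗ avgAdj wX W q) y y'| ≤
      κ₁ * κ₂ * C ^ 2 * ℓ y ^ 2 * ℓ y'' ^ 2 * Real.exp (-(δ * ρ y y'')) * Real.exp (-(δ * ρ y'' y')) := by
  have hmat : mat (avgOp q ∘ₗ G ∘ₗ mulOp (fun x => if blk x = y'' then (1 : ℝ) else 0) ∘ₗ G ∘ₗ avgAdj wX W q) y y' =
      avgOp q (G (mulOp (fun x => if blk x = y'' then (1 : ℝ) else 0) (G (avgAdj wX W q (Pi.single y' 1))))) y := rfl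
  rw [hmat]
  -- `J = Q′*δ_{y′}`: supported in `B(y′)`, bounded by `κ₂`
  set J := avgAdj wX W q (Pi.single y' 1) with hJ
  have hqR' : ∀ b x, q b x ≠ 0 → x ∈ (fun b : S => {x : X | blk x = b}) b := fun b x h => hqR b x h
  have hJsupp : ∀ x, J x ≠ 0 → blk x = y' := fun x hx => avgAdj_single_support hqR' wX W hx
  have hJle : ∀ x, |J x| ≤ κ₂ := fun x => abs_avgAdj_single_le hwX hW hq2 y' x
  -- `F = Δ(y″)G′J`: supported in `B(y″)`, bounded by (2.67)₁ at (y″, y′)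
  set F := mulOp (fun x => if blk x = y'' then (1 : ℝ) else 0) (G J) with hF
  set M'' := C * ℓ y'' ^ 2 * Real.exp (-(δ * ρ y'' y')) * κ₂ with hM''
  have hM''0 : 0 ≤ M'' := by positivity
  have hFsupp : ∀ x, F x ≠ 0 → blk x = y'' := by
    intro x hx
    by_contra hne
    exact hx (by simp [hF, mulOp_apply, hne])
  have hFle : ∀ x, |F x| ≤ M'' := by
    intro x
    by_cases hx : blk x = y''
    · have h := h267 y'' y' J κ₂ hJsupp hJle x hx
      simpa [hF, mulOp_apply, hx, hM''] using h
    · simp [hF, mulOp_apply, hx, hM''0]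
  -- `G′F` on `B(y)`: (2.67)₁ at (y, y″); then `Q′` costs `κ₁`
  have hGF : ∀ x, blk x = y → |G F x| ≤ C * ℓ y ^ 2 * Real.exp (-(δ * ρ y y'')) * M'' :=
    h267 y y'' F M'' hFsupp hFle
  have hM0 : 0 ≤ C * ℓ y ^ 2 * Real.exp (-(δ * ρ y y'')) * M'' := by positivity
  calc |avgOp q (G F) y| ≤ κ₁ * (C * ℓ y ^ 2 * Real.exp (-(δ * ρ y y'')) * M'') :=
        abs_avgOp_le q hqR' hq1 (G F) y hM0 (fun x hx => hGF x hx)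
    _ = κ₁ * κ₂ * C ^ 2 * ℓ y ^ 2 * ℓ y'' ^ 2 * Real.exp (-(δ * ρ y y'')) * Real.exp (-(δ * ρ y'' y')) := by
        simp only [hM'']
        ring

/-- **Members 1–3 of (2.68), summed** (matrix-entry form): `|(Q′G′²Q′*δ_{y′})(y)| ≤
κ₁κ₂C²ℓ(y)² Σ_{y″} ℓ(y″)²e^{−δρ(y,y″)}e^{−δρ(y″,y′)}`. [cite: Balaban1984PropagatorsII, (2.68) p.235] -/
theorem line2_abs_of_267 (G : Module.End ℝ (X → ℝ)) (q : S → X → ℝ) (blk : X → S) {wX : ℝ} {W : S → ℝ}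
    (ℓ : S → ℝ) (ρ : S → S → ℝ) {C δ κ₁ κ₂ : ℝ}
    (hwX : 0 < wX) (hW : ∀ b, 0 < W b) (hC : 0 ≤ C) (hκ₂ : 0 ≤ κ₂)
    (hqR : ∀ b x, q b x ≠ 0 → blk x = b) (hq1 : ∀ b, ∑ x, |q b x| ≤ κ₁)
    (hq2 : ∀ b x, |q b x| ≤ κ₂ * wX / W b)
    (h267 : ∀ (b b' : S) (J : X → ℝ) (M : ℝ), (∀ x, J x ≠ 0 → blk x = b') → (∀ x, |J x| ≤ M) →
      ∀ x, blk x = b → |G J x| ≤ C * ℓ b ^ 2 * Real.exp (-(δ * ρ b b')) * M)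
    (y y' : S) :
    |mat (avgOp q ∘ₗ G ∘ₗ G ∘ₗ avgAdj wX W q) y y'| ≤
      κ₁ * κ₂ * C ^ 2 * ℓ y ^ 2 *
        ∑ y'' : S, ℓ y'' ^ 2 * Real.exp (-(δ * ρ y y'')) * Real.exp (-(δ * ρ y'' y')) := by
  rw [member1 q G wX W blk y y']
  calc |∑ y'' : S, mat (avgOp q ∘ₗ G ∘ₗ mulOp (fun x => if blk x = y'' then (1 : ℝ) else 0) ∘ₗ G ∘ₗ
          avgAdj wX W q) y y'|
      ≤ ∑ y'' : S, |mat (avgOp q ∘ₗ G ∘ₗ mulOp (fun x => if blk x = y'' then (1 : ℝ) else 0) ∘ₗ G ∘ₗ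
          avgAdj wX W q) y y'| := Finset.abs_sum_le_sum_abs _ _
    _ ≤ ∑ y'' : S, κ₁ * κ₂ * C ^ 2 * ℓ y ^ 2 * ℓ y'' ^ 2 * Real.exp (-(δ * ρ y y'')) *
          Real.exp (-(δ * ρ y'' y')) :=
        Finset.sum_le_sum fun y'' _ => member23 G q blk ℓ ρ hwX hW hC hκ₂ hqR hq1 hq2 h267 y y'' y'
    _ = κ₁ * κ₂ * C ^ 2 * ℓ y ^ 2 *
          ∑ y'' : S, ℓ y'' ^ 2 * Real.exp (-(δ * ρ y y'')) * Real.exp (-(δ * ρ y'' y')) := by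
        rw [Finset.mul_sum]
        exact Finset.sum_congr rfl fun y'' _ => by ring

/-- **Members 1–3 of (2.68), summed, (2.69)-kernel form**: the kernel `X(y,y′) = (Tδ_{y′})(y)/W(y′)` of `T = Q′G′²Q′*`
obeys `|X(y,y′)| ≤ κ₁κ₂C²ℓ(y)²W(y′)⁻¹ Σ_{y″} ℓ(y″)²e^{−δρ(y,y″)}e^{−δρ(y″,y′)}` — with `W(y′) = (L^{j′}η)^d` this is
the factor `(L^{j′}η)^{−d}` of member 3. [cite: Balaban1984PropagatorsII, (2.68) p.235] -/
theorem line2_kernel_of_267 (G : Module.End ℝ (X → ℝ)) (q : S → X → ℝ) (blk : X → S) {wX : ℝ} {W : S → ℝ}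
    (ℓ : S → ℝ) (ρ : S → S → ℝ) {C δ κ₁ κ₂ : ℝ}
    (hwX : 0 < wX) (hW : ∀ b, 0 < W b) (hC : 0 ≤ C) (hκ₂ : 0 ≤ κ₂)
    (hqR : ∀ b x, q b x ≠ 0 → blk x = b) (hq1 : ∀ b, ∑ x, |q b x| ≤ κ₁)
    (hq2 : ∀ b x, |q b x| ≤ κ₂ * wX / W b)
    (h267 : ∀ (b b' : S) (J : X → ℝ) (M : ℝ), (∀ x, J x ≠ 0 → blk x = b') → (∀ x, |J x| ≤ M) →
      ∀ x, blk x = b → |G J x| ≤ C * ℓ b ^ 2 * Real.exp (-(δ * ρ b b')) * M)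
    (y y' : S) :
    |kernelW W (avgOp q ∘ₗ G ∘ₗ G ∘ₗ avgAdj wX W q) y y'| ≤
      κ₁ * κ₂ * C ^ 2 * ℓ y ^ 2 * (W y')⁻¹ *
        ∑ y'' : S, ℓ y'' ^ 2 * Real.exp (-(δ * ρ y y'')) * Real.exp (-(δ * ρ y'' y')) := by
  have hWb := hW y'
  have h := line2_abs_of_267 G q blk ℓ ρ hwX hW hC hκ₂ hqR hq1 hq2 h267 y y'
  show |mat (avgOp q ∘ₗ G ∘ₗ G ∘ₗ avgAdj wX W q) y y' / W y'| ≤ _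
  rw [abs_div, abs_of_pos hWb]
  calc |mat (avgOp q ∘ₗ G ∘ₗ G ∘ₗ avgAdj wX W q) y y'| / W y'
      ≤ (κ₁ * κ₂ * C ^ 2 * ℓ y ^ 2 *
          ∑ y'' : S, ℓ y'' ^ 2 * Real.exp (-(δ * ρ y y'')) * Real.exp (-(δ * ρ y'' y'))) / W y' :=
        div_le_div_of_nonneg_right h hWb.le
    _ = κ₁ * κ₂ * C ^ 2 * ℓ y ^ 2 * (W y')⁻¹ *
          ∑ y'' : S, ℓ y'' ^ 2 * Real.exp (-(δ * ρ y y'')) * Real.exp (-(δ * ρ y'' y')) := by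
        ring

end Fine

/-! ## §2 Over the carrier `g : B6.Geometry`: members 1–3, then the tree's members 3–6 -/

section Geometry

open B6

/-- **(2.67)₁ ⟹ (2.68) line 2** over `g : B6.Geometry` (sites of 𝔅 = `g.Site`, ℓ = L^jη = `len`, W = len^d, ρ = d):
for any linear `G′` on the fine lattice with (2.67)₁ in operator form and any averaging kernel with the two normalisation
constants κ₁, κ₂, the (2.69)-kernel of `Q′G′²Q′*` satisfies
`|(Q′G′²Q′*)(y,y′)| ≤ κ₁κ₂C²·(L^jη)⁴(L^{j′}η)^{−d}·Σ_{y″} L^{2(j″−j)}e^{−½δ₀d(y,y″)}e^{−½δ₀d(y″,y′)}`, i.e. members 1–3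
with `(L^{j″}η)² = (L^jη)²L^{2(j″−j)}` (`B6Ineq268.len_sq_eq`), the last factor being `B6Ineq268.line2`.
[cite: Balaban1984PropagatorsII, (2.68) p.235] -/
theorem line2_of_267 (g : Geometry) [DecidableEq g.Site] (d : ℕ) {Y : Type} [Fintype Y]
    (G : Module.End ℝ (Y → ℝ)) (q : g.Site → Y → ℝ) (blk : Y → g.Site) {wX C δ₀ κ₁ κ₂ : ℝ}
    (hwX : 0 < wX) (hL : 0 < g.L) (hη : 0 < g.eta) (hC : 0 ≤ C) (hκ₂ : 0 ≤ κ₂)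
    (hqR : ∀ b x, q b x ≠ 0 → blk x = b) (hq1 : ∀ b, ∑ x, |q b x| ≤ κ₁)
    (hq2 : ∀ b x, |q b x| ≤ κ₂ * wX / g.len b ^ d)
    (h267 : ∀ (b b' : g.Site) (J : Y → ℝ) (M : ℝ), (∀ x, J x ≠ 0 → blk x = b') → (∀ x, |J x| ≤ M) →
      ∀ x, blk x = b → |G J x| ≤ C * g.len b ^ 2 * Real.exp (-(1 / 2 * δ₀ * g.dist b b')) * M)
    (y y' : g.Site) :
    |kernelW (fun z => g.len z ^ d) (avgOp q ∘ₗ G ∘ₗ G ∘ₗ avgAdj wX (fun z => g.len z ^ d) q) y y'| ≤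
      κ₁ * κ₂ * C ^ 2 * g.len y ^ 4 * (g.len y' ^ d)⁻¹ * B6Ineq268.line2 g δ₀ y y' := by
  have hlen : ∀ z : g.Site, 0 < g.len z ^ d := fun z => pow_pos (mul_pos (pow_pos hL _) hη) d
  have h := line2_kernel_of_267 G q blk g.len g.dist hwX hlen hC hκ₂ hqR hq1 hq2 h267 y y'
  have hsum : ∑ y'' : g.Site, g.len y'' ^ 2 * Real.exp (-(1 / 2 * δ₀ * g.dist y y'')) *
        Real.exp (-(1 / 2 * δ₀ * g.dist y'' y')) = g.len y ^ 2 * B6Ineq268.line2 g δ₀ y y' := by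
    unfold B6Ineq268.line2
    rw [Finset.mul_sum]
    refine Finset.sum_congr rfl fun y'' _ => ?_
    rw [B6Ineq268.len_sq_eq hL.ne' hη.ne' y y'']
    ring
  rw [hsum] at h
  calc _ ≤ _ := h
    _ = κ₁ * κ₂ * C ^ 2 * g.len y ^ 4 * (g.len y' ^ d)⁻¹ * B6Ineq268.line2 g δ₀ y y' := by ring

/-- **(2.67) ⟹ (2.68), END TO END.**  Members 1–3 (`line2_of_267`) followed by members 3–6 of the print — the
scale-sum certificate `B6Ineq268.line2_le_line5` from (2.54) (`Triangle254`), the symmetry of d, the metric content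
`LevelSep` of (2.60), (2.61) at α = ¼ with constant c, and the located threshold `L² ≤ e^{¼δ₀RM}` (8 log L ≤ δ₀RM) —
give **`|(Q′G′²Q′*)(y,y′)| ≤ O(1)(L^jη)⁴(L^{j′}η)^{−d}e^{−¼δ₀d(y,y′)}` with `O(1) = κ₁κ₂C²L²c`**.
[cite: Balaban1984PropagatorsII, (2.68) p.235] -/
theorem ineq268_of_267 (g : Geometry) [DecidableEq g.Site] (d : ℕ) {Y : Type} [Fintype Y]
    (G : Module.End ℝ (Y → ℝ)) (q : g.Site → Y → ℝ) (blk : Y → g.Site) {wX C δ₀ κ₁ κ₂ c : ℝ}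
    (hwX : 0 < wX) (hη : 0 < g.eta) (hC : 0 ≤ C) (hκ₂ : 0 ≤ κ₂)
    (hqR : ∀ b x, q b x ≠ 0 → blk x = b) (hq1 : ∀ b, ∑ x, |q b x| ≤ κ₁)
    (hq2 : ∀ b x, |q b x| ≤ κ₂ * wX / g.len b ^ d)
    (h267 : ∀ (b b' : g.Site) (J : Y → ℝ) (M : ℝ), (∀ x, J x ≠ 0 → blk x = b') → (∀ x, |J x| ≤ M) →
      ∀ x, blk x = b → |G J x| ≤ C * g.len b ^ 2 * Real.exp (-(1 / 2 * δ₀ * g.dist b b')) * M)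
    (htri : B6RandomWalk.Triangle254 g) (hsymm : B6Ineq268.Symm g) (hsep : B6Ineq268.LevelSep g)
    (hL1 : 1 ≤ g.L) (hRM : 0 ≤ g.R * g.M) (hδ : 0 ≤ δ₀) (h261 : B6Lemma21Repaired.Ineq261With c g δ₀ (1 / 4))
    (hthr : g.L ^ 2 ≤ Real.exp (1 / 4 * δ₀ * g.R * g.M)) (y y' : g.Site) :
    |kernelW (fun z => g.len z ^ d) (avgOp q ∘ₗ G ∘ₗ G ∘ₗ avgAdj wX (fun z => g.len z ^ d) q) y y'| ≤
      κ₁ * κ₂ * C ^ 2 * (g.L ^ 2 * c) * g.len y ^ 4 * (g.len y' ^ d)⁻¹ *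
        Real.exp (-(1 / 4 * δ₀ * g.dist y y')) := by
  have hL : 0 < g.L := lt_of_lt_of_le one_pos hL1
  have hleny : 0 < g.len y := mul_pos (pow_pos hL _) hη
  have hleny' : 0 < g.len y' := mul_pos (pow_pos hL _) hη
  have hκ₁ : 0 ≤ κ₁ := le_trans (Finset.sum_nonneg fun x _ => abs_nonneg _) (hq1 y)
  have h1 := line2_of_267 g d G q blk hwX hL hη hC hκ₂ hqR hq1 hq2 h267 y y'
  have h2 : B6Ineq268.line2 g δ₀ y y' ≤ g.L ^ 2 * c * B6Ineq268.line5 g δ₀ y y' :=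
    B6Ineq268.line2_le_line5 htri hsymm hsep hL1 hRM hδ h261 hthr y y'
  have hpre : 0 ≤ κ₁ * κ₂ * C ^ 2 * g.len y ^ 4 * (g.len y' ^ d)⁻¹ := by positivity
  calc _ ≤ _ := h1
    _ ≤ κ₁ * κ₂ * C ^ 2 * g.len y ^ 4 * (g.len y' ^ d)⁻¹ * (g.L ^ 2 * c * B6Ineq268.line5 g δ₀ y y') :=
        mul_le_mul_of_nonneg_left h2 hpre
    _ = κ₁ * κ₂ * C ^ 2 * (g.L ^ 2 * c) * g.len y ^ 4 * (g.len y' ^ d)⁻¹ *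
          Real.exp (-(1 / 4 * δ₀ * g.dist y y')) := by
        simp only [B6Ineq268.line5]
        ring

/-- **(2.67) ⟹ (2.68) for REALISED geometries**: when `g.dist` IS the multiscale distance (2.46) of a contour system
(`B6Geometry.Realizes`) whose admissible contours exist (`Connected`) and obey the walk form `LevelGap N` of (2.2)/(2.57)
with RM ≤ N, the hypotheses (2.54), symmetry and (2.60)/`LevelSep` of `ineq268_of_267` are DISCHARGED by the tree
(`B6Geometry.triangle254_of_realizes`, `dist_comm_of_realizes`, `ineq260_of_levelGap`); (2.61) at ¼, the threshold and
(2.67)₁ remain. [cite: Balaban1984PropagatorsII, (2.68) p.235] -/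
theorem ineq268_of_267_realizes (g : Geometry) [DecidableEq g.Site] (d : ℕ) {Y : Type} [Fintype Y]
    (G : Module.End ℝ (Y → ℝ)) (q : g.Site → Y → ℝ) (blk : Y → g.Site) {wX C δ₀ κ₁ κ₂ c : ℝ}
    {Cs : B6Geometry.ContourSystem g} (hreal : B6Geometry.Realizes g Cs) (hconn : Cs.bond.Connected) {N : ℕ}
    (hgap : B6Geometry.LevelGap Cs.bond Cs.zone N) (hRMN : g.R * g.M ≤ N)
    (hwX : 0 < wX) (hη : 0 < g.eta) (hC : 0 ≤ C) (hκ₂ : 0 ≤ κ₂)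
    (hqR : ∀ b x, q b x ≠ 0 → blk x = b) (hq1 : ∀ b, ∑ x, |q b x| ≤ κ₁)
    (hq2 : ∀ b x, |q b x| ≤ κ₂ * wX / g.len b ^ d)
    (h267 : ∀ (b b' : g.Site) (J : Y → ℝ) (M : ℝ), (∀ x, J x ≠ 0 → blk x = b') → (∀ x, |J x| ≤ M) →
      ∀ x, blk x = b → |G J x| ≤ C * g.len b ^ 2 * Real.exp (-(1 / 2 * δ₀ * g.dist b b')) * M)
    (hL1 : 1 ≤ g.L) (hRM : 0 ≤ g.R * g.M) (hδ : 0 < δ₀) (h261 : B6Lemma21Repaired.Ineq261With c g δ₀ (1 / 4))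
    (hthr : g.L ^ 2 ≤ Real.exp (1 / 4 * δ₀ * g.R * g.M)) (y y' : g.Site) :
    |kernelW (fun z => g.len z ^ d) (avgOp q ∘ₗ G ∘ₗ G ∘ₗ avgAdj wX (fun z => g.len z ^ d) q) y y'| ≤
      κ₁ * κ₂ * C ^ 2 * (g.L ^ 2 * c) * g.len y ^ 4 * (g.len y' ^ d)⁻¹ *
        Real.exp (-(1 / 4 * δ₀ * g.dist y y')) := by
  have htri : B6RandomWalk.Triangle254 g := B6Geometry.triangle254_of_realizes hreal hconn
  have hsymm : B6Ineq268.Symm g := fun a b => B6Geometry.dist_comm_of_realizes hreal a b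
  have h1δ : 0 < (1 : ℝ) * δ₀ := by simpa using hδ
  have h260 : B6RandomWalk.Ineq260 g δ₀ 1 :=
    B6Geometry.ineq260_of_levelGap hreal hconn hgap hRMN h1δ.le
  have hsep : B6Ineq268.LevelSep g := (B6Ineq268.levelSep_iff_ineq260 (g := g) h1δ).mpr h260
  exact ineq268_of_267 g d G q blk hwX hη hC hκ₂ hqR hq1 hq2 h267 htri hsymm hsep hL1 hRM hδ.le h261 hthr y y'

end Geometry


/-! ## §2b (2.67) ⟹ the (2.68)-input `hX` of Proposition 2.3's kernel chain, by name -/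

section HX

open B6

/-- **(2.67) ⟹ THE INPUT OF PROPOSITION 2.3's CHAIN, BY NAME.**  p. 235: *"Now we will consider the operator
(Q′G′²Q′*)⁻¹ … We will construct it and investigate its properties using again a random walk expansion"* — the tree's
construction (`B6Prop27Kernel.inverse_assembled_pow` at power `p = 4`, assembled in `…B6Prop23Assembled` /
`…B6Prop23Printed`) takes the bound (2.68) on the (2.69)-kernel `X` of `Q′G′²Q′*` as its hypothesis
`hX : ∀ y y″, |(L^{j″}η)^d·X(y,y″)| ≤ BX·(L^jη)^p·e^{−½δ·d(y,y″)}`.  From (2.67)₁ and the Lemma-2.1 inputs of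
`ineq268_of_267` this `hX` HOLDS LITERALLY, with `p = 4`, `BX = κ₁κ₂C²L²c` and the chain's rate parameter `δ := ½δ₀`
(so that ½δ = ¼δ₀, the rate of (2.68)), for `X = kernelW (len^d) (Q′G′²Q′*)` — whose kernel operator IS `Q′G′²Q′*`
(`B6Ineq2142.kerOp_kernelW`). [cite: Balaban1984PropagatorsII, (2.68) p.235] -/
theorem hX_of_267 (g : Geometry) [DecidableEq g.Site] (d : ℕ) {Y : Type} [Fintype Y]
    (G : Module.End ℝ (Y → ℝ)) (q : g.Site → Y → ℝ) (blk : Y → g.Site) {wX C δ₀ κ₁ κ₂ c : ℝ}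
    (hwX : 0 < wX) (hη : 0 < g.eta) (hC : 0 ≤ C) (hκ₂ : 0 ≤ κ₂)
    (hqR : ∀ b x, q b x ≠ 0 → blk x = b) (hq1 : ∀ b, ∑ x, |q b x| ≤ κ₁)
    (hq2 : ∀ b x, |q b x| ≤ κ₂ * wX / g.len b ^ d)
    (h267 : ∀ (b b' : g.Site) (J : Y → ℝ) (M : ℝ), (∀ x, J x ≠ 0 → blk x = b') → (∀ x, |J x| ≤ M) →
      ∀ x, blk x = b → |G J x| ≤ C * g.len b ^ 2 * Real.exp (-(1 / 2 * δ₀ * g.dist b b')) * M)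
    (htri : B6RandomWalk.Triangle254 g) (hsymm : B6Ineq268.Symm g) (hsep : B6Ineq268.LevelSep g)
    (hL1 : 1 ≤ g.L) (hRM : 0 ≤ g.R * g.M) (hδ : 0 ≤ δ₀) (h261 : B6Lemma21Repaired.Ineq261With c g δ₀ (1 / 4))
    (hthr : g.L ^ 2 ≤ Real.exp (1 / 4 * δ₀ * g.R * g.M)) :
    ∀ y y'' : g.Site, |g.len y'' ^ d *
        kernelW (fun z => g.len z ^ d) (avgOp q ∘ₗ G ∘ₗ G ∘ₗ avgAdj wX (fun z => g.len z ^ d) q) y y''| ≤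
      κ₁ * κ₂ * C ^ 2 * (g.L ^ 2 * c) * g.len y ^ 4 * Real.exp (-(1 / 2 * (δ₀ / 2) * g.dist y y'')) := by
  intro y y''
  have hL : 0 < g.L := lt_of_lt_of_le one_pos hL1
  have hlen : 0 < g.len y'' ^ d := pow_pos (mul_pos (pow_pos hL _) hη) d
  have h := ineq268_of_267 g d G q blk hwX hη hC hκ₂ hqR hq1 hq2 h267 htri hsymm hsep hL1 hRM hδ h261 hthr y y''
  have hrate : (1 : ℝ) / 2 * (δ₀ / 2) * g.dist y y'' = 1 / 4 * δ₀ * g.dist y y'' := by ring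
  rw [abs_mul, abs_of_pos hlen, hrate]
  calc g.len y'' ^ d *
        |kernelW (fun z => g.len z ^ d) (avgOp q ∘ₗ G ∘ₗ G ∘ₗ avgAdj wX (fun z => g.len z ^ d) q) y y''|
      ≤ g.len y'' ^ d * (κ₁ * κ₂ * C ^ 2 * (g.L ^ 2 * c) * g.len y ^ 4 * (g.len y'' ^ d)⁻¹ *
          Real.exp (-(1 / 4 * δ₀ * g.dist y y''))) := mul_le_mul_of_nonneg_left h hlen.le
    _ = κ₁ * κ₂ * C ^ 2 * (g.L ^ 2 * c) * g.len y ^ 4 * Real.exp (-(1 / 4 * δ₀ * g.dist y y'')) := by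
        field_simp

/-- … and the operator behind that kernel IS `Q′G′²Q′*` (so `hX_of_267` is a statement about the actual operator).
[cite: Balaban1984PropagatorsII, (2.68)–(2.69) p.235] -/
theorem kerOp_kernelW_QGGQ (g : Geometry) [DecidableEq g.Site] (d : ℕ) {Y : Type} [Fintype Y]
    (G : Module.End ℝ (Y → ℝ)) (q : g.Site → Y → ℝ) (wX : ℝ) (hL : 0 < g.L) (hη : 0 < g.eta) :
    B6Expansion282.kerOp (fun z => g.len z ^ d)
        (kernelW (fun z => g.len z ^ d) (avgOp q ∘ₗ G ∘ₗ G ∘ₗ avgAdj wX (fun z => g.len z ^ d) q)) =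
      avgOp q ∘ₗ G ∘ₗ G ∘ₗ avgAdj wX (fun z => g.len z ^ d) q :=
  B6Ineq2142.kerOp_kernelW (fun _ => (pow_pos (mul_pos (pow_pos hL _) hη) d).ne') _

end HX

end Literature.MathematicalPhysics.QuantumFieldTheory.Balaban1983to89.B6Ineq268From267
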